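import Summits.BirchSwinnertonDyer.Rank1Residual.F1Sign2.SquareLawAtTwo
import Summits.BirchSwinnertonDyer.Rank1Residual.F1Sign2.DescentSignAtTwo
import Literature.NumberTheory.EllipticCurves.HeegnerPoints
import Mathlib.NumberTheory.Padics.PadicNumbers
import HarnessLib

/-!
# Cell `bsd-f1-sign2` — Euler-system lens (seat `-es`, g3), landing part 6: K2-F♯ in HEEGNER CURRENCY — the tame Perrin-Riou law at two

STATEMENTS ONLY (three `@[conjecture]` candidates; nothing asserted, no proof, no named fact; typer filing of the planner's Sketch G8 — see the end of this docstring).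

Answer to -an's D-es-an-1 («K2-F_an in Heegner-index currency»).  Composing the square law K2-F♯
(`SquareLawAtTwo`, landing part 5: `v₂(δ'_k(ℓ;ψ) mod 2^k) = min(k, s + 1 + 2·d_ℓ(P))`, `2^s = #Ш(E)[2^∞]`,
`P` a generator of `E(ℚ)/tors` up to odd index, `d_ℓ(P)` its `2`-divisibility depth in `E(ℚ_ℓ)`) with the
Gross–Zagier index conjecture at `2` over a descent-admissible imaginary quadratic `K`
(`#Ш(E/K) = (I_K/(c·Tam E))²`, Gross 1991 Conj. 1.2 = GZ86 V.(2.2)) and the THEOREM-level bookkeeping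
`#Ш(E/K)[2^∞] = #Ш(E)[2^∞]·#Ш(E^{(d_K)})[2^∞]` on the clean regime (`Δ_E > 0`, `a_q(E)` odd at `q ∣ d_K`,
Tamagawa product odd; isogeny invariance of the BSD quotient for `E × E^{(d)} → Res_{K/ℚ} E`), BOTH the
Heegner index `I_K` AND `Ш(E)` CANCEL:  with `y ∈ E(ℚ)` the Heegner point `y_K` up to odd torsion
(`y_K = ±I_K·P + t`, `E(K)[2] = 0`), `J = d_ℓ(y) = d_ℓ(P) + v₂ I_K` its exact local depth, `2^{s_D} =
#Ш(E^{(d_K)})[2^∞]` and `v_c = v₂(c)`: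

  **`v₂(δ'_k(ℓ;ψ) mod 2^k) = min(k, 1 + 2·J − 2·v_c − s_D)`.**

Left side: Kato's Euler system (first Kolyvagin layer = Kurihara numbers = modular symbols); right side:
the Heegner Euler system (tame Kummer coordinate of `y_K` at the Kolyvagin prime `ℓ`, SQUARED) and the
TWIST's Ш — the finite-level, `p = 2` avatar of Perrin-Riou's formula `log BK₁ = (unit)·c(f)·(log y_K)²`
(Perrin-Riou 1993; Bertolini–Darmon–Venerucci 2022 for good ordinary odd `p`; Büyükboduk–Pollack–Sasaki
arXiv:1811.08216 Thm 1.1.5 — author names corrected per REF2 v15 (C)), with `log` at `p` replaced by the Kummer coordinate at `ℓ` and `c(f) ≐ #Ш·Tam/T²`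
replaced by `#Ш(E^{(d_K)})`.  Data: DES10 (28 726/28 726 level checks in generator currency) + DES12 (kit
des12-*: L-free `I_K` by -an's ENGINE E, `#Ш_an(E^{(d)})` by two engines, `#Ш_an(E/K)` by PARI over `K`).
0 sorry.  `LocallyTwoPowDivisible` is landing part 5's (`F1Sign2/SquareLawAtTwo.lean`, imported; the sketch's local copy in the
sub-namespace `HeegnerCurrency` is dropped — token-identical body).

TYPER FILING (seat `bsd-f1-sign2-ty` g2; CANDIDATES.md rows ES-HK / ES-HK_an / ES-HI): bodies VERBATIM from
`HOME/data-es/SketchG8.lean` bf6b217035415340 (-es g3 2026-08-27T20:23:59Z / 20:59:16Z; MEMO-es v1.6 §12.7, memo 9166efdc46a397fc;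
rc 0 / 0 sorry per -es), the only edits being the import of part 5, the removal of the local `LocallyTwoPowDivisible` copy, and one author-name correction in this docstring.
BC5 witness (DES12, kit j289084 smoke / j289197 full / j290284 F-shard-5 rerun): Heegner-currency square law P12.2A 16 303/16 303
level checks (3 903 uncensored), clean regime = the typed Prop P12.2B 4 440/4 440 (1 112 uncensored), 0 mismatch; ES-HI: Gross 1.2 ⊗ ℤ₂
over K κ_K = 0 on 333/333 certified pairs, ℚ-side κ_I − s − s_D = μ_bk 333/333 (+ DES10 j288175, 28 726/28 726 in generator currency).
REF2 v14 (a0bb009b2109c2fd §0/§1, 20:39:10Z): ES-HK/HK_an IN-PRINT-ANALOGUE ∘ ASSEMBLY, conjecture-grade (PR93 §3.3 square = BDV 2022 /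
arXiv:1811.08216 Thm 1.1.5 at odd p; transport MR04 + Gross 1991 6.2(2); bookkeeping K2-F♯ ∘ GZ₂ ∘ Kramer/Milne); not a sentence in
print at any p; beyond-print NO (no currency beyond K2-F♯). ES-HI: in-print-assembly (GZ V.(2.2) ⊗ ℤ₂ ∘ Milne 1972 ∘ Kramer), support,
filed for the ℚ-side reading only; REF2 v15 (4f5319fb6d62b9c7, 21:16:33Z) (C): v14 grade stands. REF1-AUDIT-v1 §29 (5615ef40d6a2bc41, 21:16:48Z,
evidence `HOME/REF1-data/b26/`): as-is rc 0, A1 rc 0 (`Iff.rfl` read-back of ES-HK; the `Dt`-scaling junk family checked invariant: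
`Dt.c = m·c_W` ⇒ `J ↦ J + v₂ m`, `v_c ↦ v_c + v₂ m`), BC7 CLEAN; the typer's traps answered (s_D binder present; exact-depth pair silent iff
`ỹ₂ = 0`, intended; twist orientation immaterial; quantifier order as AN-10H; s_D not forced); verdicts `HeegnerSquareLawAtTwo` /
`AnalyticHeegnerSquareLawAtTwo` SURVIVE conjecture-grade (= K2-F♯ ∘ [GZ V.(2.2)]₂ ∘ Kramer/Milne, agreeing REF2 v14), `HeegnerIndexTwistShaAtTwo`
SURVIVES (support) — «file after part 5 lands with the part-5 `LocallyTwoPowDivisible`» (done: part 5 = p572165). PARTITION: none moved;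
beyond-print theorem: no. bears_on: `stmt-BirchSwinnertonDyer-19099` (K2-F line; composes part 5 `SquareLawAtTwo`, AN-10H `DescentSignHeegnerIndexAtTwo`).
-/

noncomputable section

open scoped Classical

namespace Summit.BirchSwinnertonDyer.Rank1Residual.F1Sign2.HeegnerCurrency

open Literature.NumberTheory.EllipticCurves Literature.NumberTheory.EllipticCurves.ModularForms
open CongruenceSubgroup

/-- **ES-HK `HeegnerSquareLawAtTwo` (candidate; conjecture NEW — the tame Perrin-Riou law at two).**
Setting: `E/ℚ` globally minimal of conductor `N`, modular parametrisation datum `Dt` (newform `Dt.f`, Manin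
constant `Dt.c`), period transfer at `2` for `Dt.f`, `ρ_{E,2^∞}` onto, odd torsion, odd Tamagawa product,
`w = −1`, rank `1`, `Δ_E > 0`; `K` imaginary quadratic with `d_K` descent-admissible (`d_K ≡ 1 (8)`, `a_q(E)` odd
at `q ∣ d_K`, odd bad primes split — Heegner hypothesis), `W'` a globally minimal model of `E^{(d_K)}` of rank `0`
with `#Ш(W')[2^∞] = 2^{s_D}`; `P ∈ E(K)` mapping to the Heegner point of `(Dt, H)`, of infinite order; `y ∈ E(ℚ)`
with `P − y` of odd order (exists: `σ y_K = y_K` mod torsion for `w = −1`, `E(K)[2] = 0`); `ℓ` a level-`k`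
`τ`-prime, `ψ : (ℤ/ℓ)ˣ ↠ ℤ/2^k`, and `J` the EXACT depth of `y` in `E(ℚ_ℓ)` (`y ∈ 2^J E(ℚ_ℓ) ∖ 2^{J+1} E(ℚ_ℓ)`).
CLAIM: `δ'_k(ℓ;ψ) ∈ 2^n ℤ_{(2)}` for every `n ≤ k` with `n + s_D + 2 v₂(c) ≤ 1 + 2J`, and
`δ'_k(ℓ;ψ) ∉ 2^n ℤ_{(2)}` for `n ≤ k` with `n + s_D + 2 v₂(c) = 2 + 2J`; i.e.
`v₂(δ'_k(ℓ;ψ) mod 2^k) = min(k, 1 + 2J − 2v₂(c) − s_D)`.  (No clause for `y` censored at `ℓ`: then `P` may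
still be uncensored and K2-F♯ gives a valuation `< k`.)
Why it might fail: (i) Gross–Zagier V.(2.2) ⊗ ℤ₂ (the prime `2` is excluded from every proved case of the GZ
index formula: Kolyvagin, Zhang, Jetchev–Skinner–Wan, Castella et al.); (ii) the multiplicativity
`Ш(E/K)[2^∞] = Ш(E)[2^∞] ⊕ Ш(E^{(d)})[2^∞]` off the clean regime (it fails by `2^μ`, `2^μ = C_d·c_∞·u_d/2`);
(iii) K2-F♯ itself.  Cheapest falsifier: ONE DES12 Kim-class pair with certified `I_K`, agreeing `#Ш_an(E^{(d)})`
engines and `2 v₂ I_K ≠ s_an(E) + s_D` (Δ > 0, `a_q` odd), or one uncensored DES10 row of such a pair off the law.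
Sources: Gross–Zagier, Invent. Math. 84 (1986) V.(2.2); Gross, in «L-functions and Arithmetic» (1991) Conj. 1.2,
Prop. 2.1–2.3; Perrin-Riou, Ann. Inst. Fourier 43 (1993) §3.3; Bertolini–Darmon–Venerucci, Adv. Math. 398 (2022)
108172; arXiv:1811.08216 Thm 1.1.5; Kurihara arXiv:1407.2465 §3; Kramer, Trans. AMS 264 (1981) Thm 1;
Milne, Invent. Math. 17 (1972) (BSD and Weil restriction).  Tree objects this composes (not restates): K2-F♯
`SquareLawAtTwo` (landing part 5), the «bsd-p2» `K`-side identity (`X5.O1.RankOneIndexIdentityAtTwo`,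
`P2.bsdp_iff_bsdp_twist_of_heegnerIndexOverK`), -an AN-10H `DescentSignHeegnerIndexAtTwo` (the `s = 0` bit). -/
@[conjecture] def HeegnerSquareLawAtTwo : Prop :=
  ∀ (W : WeierstrassCurve ℚ) [W.IsElliptic] [W.IsGloballyMinimal] [NeZero (W.conductorNorm ℤ)]
    (Dt : ModularParametrizationData W (W.conductorNorm ℤ)), PeriodTransferAtTwo W Dt.f →
    (∀ n : ℕ, W.HasSurjectiveModNGaloisRep ((2 ^ n : ℕ) : ℤ)) → Odd W.torsionOrder → Odd W.tamagawaProduct →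
    W.rootNumber = -1 → W.mordellWeilRank = 1 → 0 < W.Δ →
    ∀ (K : Type) [Field K] [NumberField K], IsImaginaryQuadratic K → DescAdmissible W (NumberField.discr K) →
    ∀ (W' : WeierstrassCurve ℚ) [W'.IsElliptic] [W'.IsGloballyMinimal],
      (∃ C : WeierstrassCurve.VariableChange ℚ, C • W' = W.quadraticTwist (NumberField.discr K : ℚ)) →
      W'.mordellWeilRank = 0 → Finite (AddCommGroup.primaryComponent W'.sha 2) →
    let sD := padicValNat 2 (Nat.card (AddCommGroup.primaryComponent W'.sha 2))
    let vc := padicValNat 2 Dt.c.natAbs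
    ∀ (H : HeegnerDatum (W.conductorNorm ℤ) (NumberField.discr K)) (ι : K →+* ℂ)
      (P : (W.baseChange K).toAffine.Point),
      WeierstrassCurve.Affine.Point.map ι.toRatAlgHom P = heegnerPointComplex Dt H → ¬ IsOfFinAddOrder P →
    ∀ y : (W.toAffine.baseChange ℚ).Point,
      Odd (addOrderOf (P - WeierstrassCurve.Affine.Point.baseChange (W' := W.toAffine) ℚ K y)) →
    ∀ (ℓ k J : ℕ) [Fact ℓ.Prime], IsLevelAtTwo W ℓ → 1 ≤ k → (2 ^ k : ℤ) ∣ (ℓ : ℤ) - 1 →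
      (2 ^ k : ℤ) ∣ W.frobeniusTrace ℓ - 2 →
      ∀ ψ : (ZMod ℓ)ˣ →* Multiplicative (ZMod (2 ^ k)), Function.Surjective ψ →
        LocallyTwoPowDivisible W ℓ J y → ¬ LocallyTwoPowDivisible W ℓ (J + 1) y →
        (∀ n : ℕ, n ≤ k → n + sD + 2 * vc ≤ 1 + 2 * J → InTwoPowZLoc n (levelSumTwo Dt.f ℓ k ψ)) ∧
        (∀ n : ℕ, n ≤ k → n + sD + 2 * vc = 2 + 2 * J → ¬ InTwoPowZLoc n (levelSumTwo Dt.f ℓ k ψ))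

/-- **ES-HK_an `AnalyticHeegnerSquareLawAtTwo` (data form; what DES10 + DES12 literally test):** the same with
analytic ranks (`r_an(E) = 1`, `r_an(W') = 0`) and `s_D := v₂ #Ш_an(W')` (`shaAn W' = q`, `q ≠ 0`). -/
@[conjecture] def AnalyticHeegnerSquareLawAtTwo : Prop :=
  ∀ (W : WeierstrassCurve ℚ) [W.IsElliptic] [W.IsGloballyMinimal] [NeZero (W.conductorNorm ℤ)]
    (Dt : ModularParametrizationData W (W.conductorNorm ℤ)), PeriodTransferAtTwo W Dt.f →
    (∀ n : ℕ, W.HasSurjectiveModNGaloisRep ((2 ^ n : ℕ) : ℤ)) → Odd W.torsionOrder → Odd W.tamagawaProduct →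
    W.rootNumber = -1 → W.analyticRank = 1 → 0 < W.Δ →
    ∀ (K : Type) [Field K] [NumberField K], IsImaginaryQuadratic K → DescAdmissible W (NumberField.discr K) →
    ∀ (W' : WeierstrassCurve ℚ) [W'.IsElliptic] [W'.IsGloballyMinimal],
      (∃ C : WeierstrassCurve.VariableChange ℚ, C • W' = W.quadraticTwist (NumberField.discr K : ℚ)) →
      W'.analyticRank = 0 → ∀ q : ℚ, shaAn W' = (q : ℂ) → q ≠ 0 →
    let sD := (padicValRat 2 q).toNat
    let vc := padicValNat 2 Dt.c.natAbs
    ∀ (H : HeegnerDatum (W.conductorNorm ℤ) (NumberField.discr K)) (ι : K →+* ℂ)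
      (P : (W.baseChange K).toAffine.Point),
      WeierstrassCurve.Affine.Point.map ι.toRatAlgHom P = heegnerPointComplex Dt H → ¬ IsOfFinAddOrder P →
    ∀ y : (W.toAffine.baseChange ℚ).Point,
      Odd (addOrderOf (P - WeierstrassCurve.Affine.Point.baseChange (W' := W.toAffine) ℚ K y)) →
    ∀ (ℓ k J : ℕ) [Fact ℓ.Prime], IsLevelAtTwo W ℓ → 1 ≤ k → (2 ^ k : ℤ) ∣ (ℓ : ℤ) - 1 →
      (2 ^ k : ℤ) ∣ W.frobeniusTrace ℓ - 2 →
      ∀ ψ : (ZMod ℓ)ˣ →* Multiplicative (ZMod (2 ^ k)), Function.Surjective ψ →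
        LocallyTwoPowDivisible W ℓ J y → ¬ LocallyTwoPowDivisible W ℓ (J + 1) y →
        (∀ n : ℕ, n ≤ k → n + sD + 2 * vc ≤ 1 + 2 * J → InTwoPowZLoc n (levelSumTwo Dt.f ℓ k ψ)) ∧
        (∀ n : ℕ, n ≤ k → n + sD + 2 * vc = 2 + 2 * J → ¬ InTwoPowZLoc n (levelSumTwo Dt.f ℓ k ψ))

/-- **ES-HI `HeegnerIndexTwistShaAtTwo` — GZ V.(2.2) ⊗ ℤ₂ DESCENDED TO `ℚ` on the clean regime (support;
conjecture in print, the prime 2 excluded from every proved case): the Heegner index at two reads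
`#Ш(E)[2^∞]·#Ш(E^{(d_K)})[2^∞]`.**  Same setting; with `I = [E(K) : ℤP + E(K)_tors]`:
`2·v₂ I = 2·v₂(c) + s + s_D`.  RELATION TO TREE OBJECTS (dedup): over `K` this is the sub-lane «bsd-p2» valuation
identity — `X5.O1.RankOneIndexIdentityAtTwo W K P δ` (`Rank1Residual/X5/TwoAdicTargetsLead.lean`; slack `δ`
absorbing `c`, `u_K`, torsion) and the binder `hv : ord₂(4I²/(c²w²c_K)) = ord₂ #Ш(E_K)` of
`P2.bsdp_iff_bsdp_twist_of_heegnerIndexOverK` (`Rank1Residual/P2/HeegnerIndexAtTwoOverKDescent.lean`) —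
composed with the descent `#Ш(E_K)[2^∞] = #Ш(E)[2^∞]·#Ш(E^{(d_K)})[2^∞]`, which on the clean regime
(`a_q` odd at `q ∣ d_K`, `Δ > 0`, Tam odd, `E(K)[2] = 0`) is Milne's identity (★)
`#Ш_an(E_K)·#Ш(W)·#Ш(Wd) = #Ш_an(W)·#Ш_an(Wd)·#Ш(E_K)` (`Milne1972.bsdQuotient_baseChange_quadratic`) with all
period/Tamagawa/torsion `2`-units equal to `1` (DES12 P12.B: `u_d = 1`, `C_d = 1`, `c_∞ = 2`).  What is filed
here is only the `ℚ`-side reading used by ES-HK; nothing new is claimed for it.  (DES12 P12.1 / P12.1K; -an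
TABLE H t1 on `s = 0`.) [cite: GrossZagier1986, V.(2.2)] [cite: GrossLMS1991, Conj. 1.2]
[cite: Milne1972ArithmeticAV, §1 Thm. 1] -/
@[conjecture] def HeegnerIndexTwistShaAtTwo : Prop :=
  ∀ (W : WeierstrassCurve ℚ) [W.IsElliptic] [W.IsGloballyMinimal] [NeZero (W.conductorNorm ℤ)]
    (Dt : ModularParametrizationData W (W.conductorNorm ℤ)),
    (∀ n : ℕ, W.HasSurjectiveModNGaloisRep ((2 ^ n : ℕ) : ℤ)) → Odd W.torsionOrder → Odd W.tamagawaProduct →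
    W.rootNumber = -1 → W.mordellWeilRank = 1 → 0 < W.Δ → Finite (AddCommGroup.primaryComponent W.sha 2) →
    ∀ (K : Type) [Field K] [NumberField K], IsImaginaryQuadratic K → DescAdmissible W (NumberField.discr K) →
    ∀ (W' : WeierstrassCurve ℚ) [W'.IsElliptic] [W'.IsGloballyMinimal],
      (∃ C : WeierstrassCurve.VariableChange ℚ, C • W' = W.quadraticTwist (NumberField.discr K : ℚ)) →
      W'.mordellWeilRank = 0 → Finite (AddCommGroup.primaryComponent W'.sha 2) →
    ∀ (H : HeegnerDatum (W.conductorNorm ℤ) (NumberField.discr K)) (ι : K →+* ℂ)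
      (P : (W.baseChange K).toAffine.Point),
      WeierstrassCurve.Affine.Point.map ι.toRatAlgHom P = heegnerPointComplex Dt H → ¬ IsOfFinAddOrder P →
      2 * padicValNat 2 (AddSubgroup.zmultiples P ⊔ AddCommGroup.torsion (W.baseChange K).toAffine.Point).index =
        2 * padicValNat 2 Dt.c.natAbs + padicValNat 2 (Nat.card (AddCommGroup.primaryComponent W.sha 2)) +
          padicValNat 2 (Nat.card (AddCommGroup.primaryComponent W'.sha 2))

end Summit.BirchSwinnertonDyer.Rank1Residual.F1Sign2.HeegnerCurrency

end
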